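import Literature.NumberTheory.ComplexMultiplication.CMOrderCohenMacaulayTypeOne
import Literature.NumberTheory.ComplexMultiplication.CMOrderPEquivalenceLocalIsomorphism
import Literature.NumberTheory.ComplexMultiplication.CMOrderIdealGeneratorsCount
import Mathlib.LinearAlgebra.TensorProduct.Basic
import HarnessLib

/-!
# Orders of Cohen–Macaulay type two: at a prime with `type_𝔭(𝔯) = 2` every fractional ideal with multiplicator
# ring `𝔯` is locally isomorphic to `𝔯` or to `𝔯ᵗ` (MARSEGLIA 2024 THEOREM 6.2 = MAIN THEOREM 3 (1)), with
# LEMMA 6.1 (linear algebra) and COROLLARY 6.3 (`type 2 ⟺` two generators suffice)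

Family `hodge`, lane `lit-hodgefound` (Track 2 foundations library; seat p15, row g28-#1), topic
`Literature/NumberTheory/ComplexMultiplication`, namespaces `Literature.NumberTheory.ComplexMultiplication.NumberRing`
(§1 linear algebra over a field `k`; §2 any domain `R` with fraction field `K` and a maximal ideal `𝔭`) and
`…CMTypeLattice` (§§3–4: the order `𝔯 = endOrder (M_μ)` of a number field `K` of any degree, its trace dual `T = 𝔯ᵗ`
with `↑T = traceDual ℤ ℚ ↑1`, the local type `type_𝔭(𝔯) = dim_{𝔯/𝔭} 𝔯ᵗ/𝔭𝔯ᵗ = finrank (𝔯 ⧸ 𝔭) (↥↑T ⧸ 𝔭 • ⊤)` of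
`CMOrderCohenMacaulayTypeOne`).  THEOREMS ONLY: no definition, no instance, no named fact (net Literature debt `0`).
Vocabulary (no new definition): `R_𝔭 = Localization.subalgebra.ofField K 𝔭.primeCompl _ ⊆ K`, `I_𝔭 = span R_𝔭 ↑I`;
«`I_𝔭 ≃ J_𝔭`» is, as in `CMOrderPEquivalenceLocalIsomorphism` (Marseglia 2025 Prop. 3.2 (2)), the statement
`∃ x ≠ 0, I_𝔭 = x·J_𝔭`; the multiplicator-ring condition `(I:I) = S` is `I / I = 1`; `gens_𝔯(I)` is Mathlib's
`Submodule.spanFinrank` (`CMOrderIdealGeneratorsCount`).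

## Source, VERBATIM

S. Marseglia, *Cohen-Macaulay type of orders, generators and ideal classes*, J. Algebra 658 (2024) 247–276
[Marseglia2024CMType] (arXiv:2206.03758, held `paper:arxiv-2206.03758`), §6, chunk p0013:

> "Lemma 6.1 ([MarsegliaSuperMult]). Let `U, V` and `W` be vector spaces over a field `k`, with `W` of dimension
> `≥ 2`. Let `φ : U ⊗ V ↠ W` be a surjective linear map. Then there exists an element `u ∈ U` such that
> `dim_k(φ(u ⊗ V)) ≥ 2`, or there exists an element `v ∈ V` such that `dim_k(φ(U ⊗ v)) ≥ 2`."
>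
> "Theorem 6.2. Let `S` be an order, `𝔭` a prime of `S` and `I` a fractional `S`-ideal with `(I:I) = S`. Assume that
> `type_𝔭(S) = 2`. Then either `I_𝔭 ≃ S_𝔭` or `I_𝔭 ≃ (Sᵗ)_𝔭`.  Proof. Put `k = S/𝔭` and consider the following
> finite dimensional `k`-vector spaces: `U = I/𝔭I`, `V = Iᵗ/𝔭Iᵗ`, `W = Sᵗ/𝔭Sᵗ`. By Lemma 2.4.(iii) we have that
> `Sᵗ = (I:I)ᵗ = IIᵗ`. It follows that the multiplication map `I ⊗_S Iᵗ → Sᵗ` is a surjective `S`-linear morphism.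
> In particular the induced `k`-linear morphism `π : U ⊗_k V → W` is a surjective map onto a `2`-dimensional vector
> space. By Lemma 6.1 there exists (i) `u ∈ I` such that `π(u + 𝔭I ⊗ V) = W`, or (ii) `v ∈ Iᵗ` such that
> `π(U ⊗ v + 𝔭Iᵗ) = W`. Assume that (i) holds, that is, `π(u + 𝔭I ⊗ V) = (uIᵗ + 𝔭Sᵗ)/𝔭Sᵗ = W`. […] By Nakayama's
> Lemma we obtain that `{uβ_k}` gives a set of generators over `Ŝ_𝔭` for `Ŝᵗ_𝔭`. […] `uÎᵗ_𝔭 = Ŝᵗ_𝔭`, which is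
> equivalent to `Î_𝔭 = uŜ_𝔭`. By [Eisenbud95] we get that `I_𝔭 ≃ S_𝔭` as an `S_𝔭`-module. If (ii) holds, then by
> a similar argument we get that `vÎ_𝔭 = Ŝᵗ_𝔭` and hence `I_𝔭 ≃ (Sᵗ)_𝔭`."
>
> "Corollary 6.3. Let `S` be a non-Gorenstein order. Then the following are equivalent: `type(S) = 2`.
> `max{gens_S(I) : fractional S-ideal I with S = (I:I)} = 2`."

and §1, chunk p0003, Main Theorem 3 (1): "Let `𝔭` be a prime of `S` and `I` a fractional `S`-ideal with `(I:I) = S`.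
If `type_𝔭(S) = 2` then either `I_𝔭 ≃ S_𝔭` or `I_𝔭 ≃ (Sᵗ)_𝔭`."

## What is formalised, and where the road is shorter than the printed one

* §1 **LEMMA 6.1, `NumberRing.exists_two_le_finrank_span_range_of_map_add`**: for a map `β : U → V → W` into a
  finite-dimensional `k`-space which is additive in the first variable, whose values span `W`, `dim W ≥ 2`: some
  `u` has `dim span β(u,V) ≥ 2` or some `v` has `dim span β(U,v) ≥ 2` (direct proof: otherwise all values lie on one
  line); and the printed tensor form **`exists_two_le_finrank_range_of_surjective`** (`φ : U ⊗[k] V →ₗ W` surjective).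
* §2 (any domain) the Nakayama step **`NumberRing.span_coe_eq_span_singleton_mul_of_span_mkQ_eq_top`**: if the
  classes of `uJ ⊆ T` span `T/𝔭T` then `T_𝔭 = u·J_𝔭`; `span_mkQ_image_eq_top_of_mul_eq` (the classes of the
  products span `T/𝔭T` when `IJ = T`); the dichotomy **`exists_span_coe_eq_span_singleton_mul_or_of_finrank_eq_two`**
  (`IJ = T`, `dim T/𝔭T = 2 ⟹ T_𝔭 = u·J_𝔭` for some `u ∈ I` or `T_𝔭 = v·I_𝔭` for some `v ∈ J`); the invariance
  of `dim I/𝔭I`: `finrank_quotient_smul_top_eq_of_linearEquiv` (along an `R`-isomorphism),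
  `finrank_quotient_smul_top_eq_of_span_coe_eq` (it only depends on `I_𝔭`) and
  **`finrank_quotient_smul_top_eq_of_span_coe_eq_span_singleton_mul`** (`I_𝔭 = x·J_𝔭 ⟹ dim I/𝔭I = dim J/𝔭J`).
* §3 **THEOREM 6.2 = MAIN THEOREM 3 (1),
  `CMTypeLattice.exists_span_coe_eq_span_singleton_mul_of_finrank_traceDual_quotient_eq_two`**: for the order
  `𝔯 = endOrder (M_μ)`, a prime `𝔭 ≠ 0` with `type_𝔭(𝔯) = 2` and `I ≠ 0` with `I / I = 1`:
  `(∃ x ≠ 0, I_𝔭 = x·𝔯_𝔭) ∨ (∃ x ≠ 0, I_𝔭 = x·𝔯ᵗ_𝔭)`; variant `isPrincipal_span_coe_or_…` («`I_𝔭` principal or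
  `I_𝔭 = x·𝔯ᵗ_𝔭`»).  The printed proof passes to the completion and descends with [Eisenbud95]; here case (i) ends
  with NAK over `𝔯_𝔭` (`𝔯ᵗ_𝔭 = u·Iᵗ_𝔭`) followed by the trace-dual transport `(𝔯ᵗ:Iᵗ)(Iᵗ:𝔯ᵗ) = (I:𝔯)(𝔯:I)`
  (`CMOrderGorenstein`) and «`𝔭`-equivalent ⟹ locally isomorphic» (`CMOrderPEquivalenceLocalIsomorphism`), and
  case (ii) ends with NAK alone (`𝔯ᵗ_𝔭 = v·I_𝔭`) — a genuinely shorter road in the tree's vocabulary, same statement.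
* §4 **COROLLARY 6.3**: prime by prime `finrank_quotient_smul_top_le_two_of_finrank_traceDual_quotient_eq_two`
  (`type_𝔭 = 2 ⟹ dim I/𝔭I ≤ 2` whenever `(I:I) = 𝔯`); globally **`forall_finrank_traceDual_quotient_le_two_iff`**
  (`type_𝔭(𝔯) ≤ 2` at every prime `⟺ gens_𝔯(I) ≤ 2` for every `I` with `(I:I) = 𝔯`, via LEMMA 4.2 of
  `CMOrderIdealGeneratorsCount`), `spanFinrank_traceDual_eq_two` (`gens_𝔯(𝔯ᵗ) = 2` when the type is `2`) and the
  printed form **`type_eq_two_iff_gens_eq_two`** for a non-Gorenstein `𝔯` («`max = 2`» read as «`≤ 2` everywhere and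
  `= 2` somewhere»).
-/

noncomputable section

open scoped nonZeroDivisors NumberField TensorProduct Pointwise
open NumberField Module FractionalIdeal
open Submodule (traceDual)

namespace Literature.NumberTheory.ComplexMultiplication

namespace NumberRing

/-! ## §1 LEMMA 6.1: a bilinear surjection onto a plane is already surjective on a slice -/

section LinearAlgebra

variable {k : Type*} [Field k] {W : Type*} [AddCommGroup W] [Module k W] [FiniteDimensional k W]

/-- A subspace of dimension `≤ 1` containing a nonzero vector `w` is the line `kw`. [cite: Marseglia2024CMType, §6
Lemma 6.1 (proof mechanism), p. 13] -/
private theorem eq_span_singleton_of_finrank_le_one {L : Submodule k W} (hL : Module.finrank k L ≤ 1) {w : W}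
    (hw : w ∈ L) (hw0 : w ≠ 0) : L = k ∙ w := by
  have h1 : Module.finrank k (k ∙ w) = 1 := finrank_span_singleton hw0
  have hle : (k ∙ w) ≤ L := (Submodule.span_singleton_le_iff_mem w L).2 hw
  exact (Submodule.eq_of_le_of_finrank_le hle (by omega)).symm

omit [FiniteDimensional k W] in
/-- Two lines through non-proportional vectors meet only in `0`. [cite: Marseglia2024CMType, §6 Lemma 6.1 (proof
mechanism), p. 13] -/
private theorem eq_zero_of_mem_span_singleton_of_mem_span_singleton {w₁ w₂ x : W} (h : w₂ ∉ k ∙ w₁)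
    (hx₁ : x ∈ k ∙ w₁) (hx₂ : x ∈ k ∙ w₂) : x = 0 := by
  obtain ⟨a, rfl⟩ := Submodule.mem_span_singleton.1 hx₁
  obtain ⟨b, hb⟩ := Submodule.mem_span_singleton.1 hx₂
  by_cases hb0 : b = 0
  · rw [← hb, hb0, zero_smul]
  · exfalso
    refine h (Submodule.mem_span_singleton.2 ⟨b⁻¹ * a, ?_⟩)
    rw [mul_smul, ← hb, smul_smul, inv_mul_cancel₀ hb0, one_smul]

/-- **MARSEGLIA 2024 LEMMA 6.1 (from [MarsegliaSuperMult]), for a map additive in the first variable**: let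
`β : U → V → W` take values in a `k`-vector space `W` of dimension `≥ 2`, be additive in `u`, and have values spanning
`W`; then some slice `β(u, V)` spans a subspace of dimension `≥ 2`, or some slice `β(U, v)` does.  (Otherwise every
slice lies on a line; for values `w₁ = β(u₁,v₁) ≠ 0` and `w₂ = β(u₂,v₂) ∉ kw₁` one gets `β(u₁,v₂) = β(u₂,v₁) = 0`, so the
slice of `u₁ + u₂` contains both `w₁` and `w₂` — a contradiction; hence all values lie on the line `kw₁`.)
[cite: Marseglia2024CMType, §6 Lemma 6.1, p. 13] -/
theorem exists_two_le_finrank_span_range_of_map_add {U : Type*} [AddCommMonoid U] {V : Type*} (β : U → V → W)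
    (hadd : ∀ u u' v, β (u + u') v = β u v + β u' v)
    (hspan : Submodule.span k {w | ∃ u v, β u v = w} = ⊤) (h2 : 2 ≤ Module.finrank k W) :
    (∃ u, 2 ≤ Module.finrank k (Submodule.span k (Set.range (β u)))) ∨
      ∃ v, 2 ≤ Module.finrank k (Submodule.span k (Set.range fun u ↦ β u v)) := by
  by_contra h
  push Not at h
  obtain ⟨hU, hV⟩ := h
  -- all values lie on the line through any nonzero value
  have key : ∀ u₁ v₁, β u₁ v₁ ≠ 0 → ∀ u₂ v₂, β u₂ v₂ ∈ k ∙ β u₁ v₁ := by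
    intro u₁ v₁ h0 u₂ v₂
    by_contra hn
    have h02 : β u₂ v₂ ≠ 0 := fun h ↦ hn (h ▸ Submodule.zero_mem _)
    have hL1 : Submodule.span k (Set.range (β u₁)) = k ∙ β u₁ v₁ :=
      eq_span_singleton_of_finrank_le_one (by have := hU u₁; omega) (Submodule.subset_span ⟨v₁, rfl⟩) h0
    have hL2 : Submodule.span k (Set.range (β u₂)) = k ∙ β u₂ v₂ :=
      eq_span_singleton_of_finrank_le_one (by have := hU u₂; omega) (Submodule.subset_span ⟨v₂, rfl⟩) h02
    have hM1 : Submodule.span k (Set.range fun u ↦ β u v₁) = k ∙ β u₁ v₁ :=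
      eq_span_singleton_of_finrank_le_one (by have := hV v₁; omega) (Submodule.subset_span ⟨u₁, rfl⟩) h0
    have hM2 : Submodule.span k (Set.range fun u ↦ β u v₂) = k ∙ β u₂ v₂ :=
      eq_span_singleton_of_finrank_le_one (by have := hV v₂; omega) (Submodule.subset_span ⟨u₂, rfl⟩) h02
    have h12 : β u₁ v₂ = 0 := by
      refine eq_zero_of_mem_span_singleton_of_mem_span_singleton hn ?_ ?_
      · rw [← hL1]; exact Submodule.subset_span ⟨v₂, rfl⟩
      · rw [← hM2]; exact Submodule.subset_span ⟨u₁, rfl⟩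
    have h21 : β u₂ v₁ = 0 := by
      refine eq_zero_of_mem_span_singleton_of_mem_span_singleton hn ?_ ?_
      · rw [← hM1]; exact Submodule.subset_span ⟨u₂, rfl⟩
      · rw [← hL2]; exact Submodule.subset_span ⟨v₁, rfl⟩
    -- the slice of `u₁ + u₂` contains `w₁` and `w₂`
    have hs1 : β (u₁ + u₂) v₁ = β u₁ v₁ := by rw [hadd, h21, add_zero]
    have hs2 : β (u₁ + u₂) v₂ = β u₂ v₂ := by rw [hadd, h12, zero_add]
    have hL : Submodule.span k (Set.range (β (u₁ + u₂))) = k ∙ β u₁ v₁ :=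
      eq_span_singleton_of_finrank_le_one (by have := hU (u₁ + u₂); omega)
        (hs1 ▸ Submodule.subset_span ⟨v₁, rfl⟩) h0
    refine hn ?_
    rw [← hL, ← hs2]
    exact Submodule.subset_span ⟨v₂, rfl⟩
  by_cases hz : ∀ u v, β u v = 0
  · -- all values vanish: `W = 0`
    have hbot : Submodule.span k {w | ∃ u v, β u v = w} = ⊥ := by
      rw [Submodule.span_eq_bot]
      rintro w ⟨u, v, rfl⟩
      exact hz u v
    rw [hspan] at hbot
    have h0 : Module.finrank k (⊤ : Submodule k W) = Module.finrank k (⊥ : Submodule k W) := by rw [hbot]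
    rw [finrank_top, finrank_bot] at h0
    omega
  · push Not at hz
    obtain ⟨u₁, v₁, h0⟩ := hz
    have hle : (⊤ : Submodule k W) ≤ k ∙ β u₁ v₁ := by
      rw [← hspan]
      refine Submodule.span_le.2 ?_
      rintro w ⟨u, v, rfl⟩
      exact key u₁ v₁ h0 u v
    have h1 := Submodule.finrank_mono hle
    rw [finrank_top, finrank_span_singleton h0] at h1
    omega

/-- **MARSEGLIA 2024 LEMMA 6.1 AS PRINTED: for a surjective linear map `φ : U ⊗ V ↠ W` onto a space of dimension
`≥ 2` there is `u ∈ U` with `dim_k φ(u ⊗ V) ≥ 2` or `v ∈ V` with `dim_k φ(U ⊗ v) ≥ 2`.**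
[cite: Marseglia2024CMType, §6 Lemma 6.1, p. 13] -/
theorem exists_two_le_finrank_range_of_surjective {U V : Type*} [AddCommGroup U] [Module k U] [AddCommGroup V]
    [Module k V] (φ : U ⊗[k] V →ₗ[k] W) (hφ : Function.Surjective φ) (h2 : 2 ≤ Module.finrank k W) :
    (∃ u : U, 2 ≤ Module.finrank k (LinearMap.range (φ ∘ₗ TensorProduct.mk k U V u))) ∨
      ∃ v : V, 2 ≤ Module.finrank k (LinearMap.range (φ ∘ₗ (TensorProduct.mk k U V).flip v)) := by
  have hspan : Submodule.span k {w | ∃ (u : U) (v : V), φ (u ⊗ₜ v) = w} = ⊤ := by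
    rw [eq_top_iff, ← LinearMap.range_eq_top.2 hφ, LinearMap.range_eq_map, ← TensorProduct.span_tmul_eq_top,
      Submodule.map_span]
    refine Submodule.span_mono ?_
    rintro _ ⟨t, ⟨m, n, rfl⟩, rfl⟩
    exact ⟨m, n, rfl⟩
  have h := exists_two_le_finrank_span_range_of_map_add (k := k) (fun (u : U) (v : V) ↦ φ (u ⊗ₜ v))
    (fun u u' v ↦ by simp only [TensorProduct.add_tmul, map_add]) hspan h2
  refine h.imp (fun ⟨u, hu⟩ ↦ ⟨u, ?_⟩) (fun ⟨v, hv⟩ ↦ ⟨v, ?_⟩)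
  · have hr : Set.range (fun v : V ↦ φ (u ⊗ₜ[k] v)) = (LinearMap.range (φ ∘ₗ TensorProduct.mk k U V u) : Set W) := by
      rw [LinearMap.coe_range]; rfl
    rwa [hr, Submodule.span_eq] at hu
  · have hr : Set.range (fun u : U ↦ φ (u ⊗ₜ[k] v)) =
        (LinearMap.range (φ ∘ₗ (TensorProduct.mk k U V).flip v) : Set W) := by
      rw [LinearMap.coe_range]; rfl
    rwa [hr, Submodule.span_eq] at hv

end LinearAlgebra

/-! ## §2 The Nakayama step over `R_𝔭`: spanning classes of `uJ ⊆ T` in `T/𝔭T` give `T_𝔭 = u·J_𝔭` -/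

section AnyDomain

variable {R : Type*} [CommRing R] [IsDomain R] {K : Type*} [Field K] [Algebra R K] [IsFractionRing R K]

/-- **Nakayama, as used in the proof of THEOREM 6.2: if `uJ ⊆ T` and the classes of the products `uv`, `v ∈ J`,
span the `R/𝔭`-vector space `T/𝔭T`, then `T_𝔭 = u·J_𝔭`** («By Nakayama's Lemma we obtain that `{uβ_k}` gives a
set of generators […] for `Ŝᵗ_𝔭`», here over the local ring `R_𝔭` instead of the completion; `T` finitely
generated). [cite: Marseglia2024CMType, §6 Thm. 6.2 (proof, case (i)), p. 13] [cite: Matsumura1987, §2 Thm. 2.3 (i),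
p. 8] -/
theorem span_coe_eq_span_singleton_mul_of_span_mkQ_eq_top (𝔭 : Ideal R) [𝔭.IsMaximal] {T J : Submodule R K}
    (hT : T.FG) {u : K} (huJ : ∀ v ∈ J, u * v ∈ T)
    (h : Submodule.span (R ⧸ 𝔭) ((𝔭 • ⊤ : Submodule R T).mkQ '' {t : T | ∃ v ∈ J, (t : K) = u * v}) = ⊤) :
    Submodule.span (Localization.subalgebra.ofField K 𝔭.primeCompl 𝔭.primeCompl_le_nonZeroDivisors) (T : Set K) =
      Submodule.span (Localization.subalgebra.ofField K 𝔭.primeCompl 𝔭.primeCompl_le_nonZeroDivisors) {u} *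
        Submodule.span (Localization.subalgebra.ofField K 𝔭.primeCompl 𝔭.primeCompl_le_nonZeroDivisors)
          (J : Set K) := by
  have hS : ((↑) : T → K) '' {t : T | ∃ v ∈ J, (t : K) = u * v} = ({u} : Set K) * (J : Set K) := by
    ext x
    rw [Set.singleton_mul]
    constructor
    · rintro ⟨t, ⟨v, hv, htv⟩, rfl⟩
      exact ⟨v, hv, htv.symm⟩
    · rintro ⟨v, hv, rfl⟩
      exact ⟨⟨u * v, huJ v hv⟩, ⟨v, hv, rfl⟩, rfl⟩
  have hle := le_span_sup_smul_of_span_mkQ_eq_top 𝔭 T _ h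
  rw [hS] at hle
  have hsub : ({u} : Set K) * (J : Set K) ⊆ T := by
    rintro _ ⟨a, ha, v, hv, rfl⟩
    rw [Set.mem_singleton_iff.1 ha]
    exact huJ v hv
  rw [span_coe_eq_span_of_le_span_sup_smul 𝔭 hT hsub hle, Submodule.span_mul_span]

omit [IsDomain R] [IsFractionRing R K] in
/-- **«the multiplication map `I ⊗_S Iᵗ → Sᵗ` is a surjective `S`-linear morphism», read modulo `𝔭`: if `IJ = T`
then the classes of the products `uv` (`u ∈ I`, `v ∈ J`) span `T/𝔭T` over `R/𝔭`.** [cite: Marseglia2024CMType, §6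
Thm. 6.2 (proof), p. 13] -/
theorem span_mkQ_image_eq_top_of_mul_eq (𝔭 : Ideal R) {I J T : Submodule R K} (hIJ : I * J = T) :
    Submodule.span (R ⧸ 𝔭)
        ((𝔭 • ⊤ : Submodule R T).mkQ '' {t : T | ∃ u ∈ I, ∃ v ∈ J, (t : K) = u * v}) = ⊤ := by
  haveI : IsScalarTower R (R ⧸ 𝔭) (T ⧸ (𝔭 • ⊤ : Submodule R T)) :=
    IsScalarTower.of_algebraMap_smul fun _ _ ↦ rfl
  apply Submodule.restrictScalars_injective R
  rw [Submodule.restrictScalars_span R (R ⧸ 𝔭) Ideal.Quotient.mk_surjective, Submodule.restrictScalars_top,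
    ← Submodule.map_span, eq_top_iff]
  rintro x -
  obtain ⟨t, rfl⟩ := Submodule.Quotient.mk_surjective _ x
  -- `t` lies in the `R`-span of the products, as an element of `T`
  have himg : ((↑) : T → K) '' {t : T | ∃ u ∈ I, ∃ v ∈ J, (t : K) = u * v} = (I : Set K) * (J : Set K) := by
    ext x
    constructor
    · rintro ⟨t, ⟨u, hu, v, hv, htv⟩, rfl⟩
      exact ⟨u, hu, v, hv, htv.symm⟩
    · rintro ⟨u, hu, v, hv, rfl⟩
      exact ⟨⟨u * v, hIJ ▸ Submodule.mul_mem_mul hu hv⟩, ⟨u, hu, v, hv, rfl⟩, rfl⟩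
  have hmem : (t : K) ∈ Submodule.span R (((↑) : T → K) '' {t : T | ∃ u ∈ I, ∃ v ∈ J, (t : K) = u * v}) := by
    rw [himg, ← Submodule.mul_eq_span_mul_set, hIJ]
    exact t.2
  rw [← Submodule.coe_subtype, ← Submodule.map_span] at hmem
  obtain ⟨t', ht', htt'⟩ := Submodule.mem_map.1 hmem
  have htt : t' = t := Subtype.ext htt'
  rw [htt] at ht'
  exact ⟨t, ht', rfl⟩

/-- **The dichotomy behind THEOREM 6.2: if `IJ = T` and `dim_{R/𝔭} T/𝔭T = 2` then `T_𝔭 = u·J_𝔭` for some `u ∈ I`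
or `T_𝔭 = v·I_𝔭` for some `v ∈ J`** (LEMMA 6.1 for the multiplication `I × J → T/𝔭T`, then Nakayama).
[cite: Marseglia2024CMType, §6 Thm. 6.2 (proof), p. 13] -/
theorem exists_span_coe_eq_span_singleton_mul_or_of_finrank_eq_two (𝔭 : Ideal R) [h𝔭 : 𝔭.IsMaximal]
    {I J T : Submodule R K} (hT : T.FG) (hIJ : I * J = T)
    (h2 : Module.finrank (R ⧸ 𝔭) (T ⧸ (𝔭 • ⊤ : Submodule R T)) = 2) :
    (∃ u ∈ I, Submodule.span (Localization.subalgebra.ofField K 𝔭.primeCompl 𝔭.primeCompl_le_nonZeroDivisors)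
        (T : Set K) =
      Submodule.span (Localization.subalgebra.ofField K 𝔭.primeCompl 𝔭.primeCompl_le_nonZeroDivisors) {u} *
        Submodule.span (Localization.subalgebra.ofField K 𝔭.primeCompl 𝔭.primeCompl_le_nonZeroDivisors)
          (J : Set K)) ∨
      ∃ v ∈ J, Submodule.span (Localization.subalgebra.ofField K 𝔭.primeCompl 𝔭.primeCompl_le_nonZeroDivisors)
          (T : Set K) =
        Submodule.span (Localization.subalgebra.ofField K 𝔭.primeCompl 𝔭.primeCompl_le_nonZeroDivisors) {v} *
          Submodule.span (Localization.subalgebra.ofField K 𝔭.primeCompl 𝔭.primeCompl_le_nonZeroDivisors)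
            (I : Set K) := by
  letI : Field (R ⧸ 𝔭) := Ideal.Quotient.field 𝔭
  haveI := finite_quotient_smul_top 𝔭 hT
  have hmem : ∀ u ∈ I, ∀ v ∈ J, u * v ∈ T := fun u hu v hv ↦ hIJ ▸ Submodule.mul_mem_mul hu hv
  -- the multiplication, read in `W = T/𝔭T`
  have hspan : Submodule.span (R ⧸ 𝔭) {w | ∃ (u : I) (v : J),
      (𝔭 • ⊤ : Submodule R T).mkQ ⟨(u : K) * v, hmem u u.2 v v.2⟩ = w} = ⊤ := by
    rw [← span_mkQ_image_eq_top_of_mul_eq 𝔭 hIJ]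
    congr 1
    ext w
    constructor
    · rintro ⟨u, v, rfl⟩
      exact ⟨⟨(u : K) * v, hmem u u.2 v v.2⟩, ⟨u, u.2, v, v.2, rfl⟩, rfl⟩
    · rintro ⟨t, ⟨u, hu, v, hv, htv⟩, rfl⟩
      refine ⟨⟨u, hu⟩, ⟨v, hv⟩, ?_⟩
      congr 1
      exact Subtype.ext htv.symm
  obtain ⟨u, hu⟩ | ⟨v, hv⟩ := exists_two_le_finrank_span_range_of_map_add (k := R ⧸ 𝔭)
      (fun (u : I) (v : J) ↦ (𝔭 • ⊤ : Submodule R T).mkQ ⟨(u : K) * v, hmem u u.2 v v.2⟩)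
      (fun u u' v ↦ by
        rw [← map_add]
        congr 1
        exact Subtype.ext (by simp only [Submodule.coe_add, add_mul]))
      hspan h2.ge
  · -- case (i): the classes of `uJ` span `W`
    refine Or.inl ⟨u, u.2, span_coe_eq_span_singleton_mul_of_span_mkQ_eq_top 𝔭 hT (fun v hv ↦ hmem u u.2 v hv) ?_⟩
    have htop : Submodule.span (R ⧸ 𝔭) (Set.range fun v : J ↦
        (𝔭 • ⊤ : Submodule R T).mkQ ⟨(u : K) * v, hmem u u.2 v v.2⟩) = ⊤ :=
      Submodule.eq_top_of_finrank_eq (le_antisymm (Submodule.finrank_le _) (h2 ▸ hu))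
    rw [← htop]
    congr 1
    ext w
    constructor
    · rintro ⟨t, ⟨v, hv, htv⟩, rfl⟩
      refine ⟨⟨v, hv⟩, ?_⟩
      change (𝔭 • ⊤ : Submodule R T).mkQ _ = _
      congr 1
      exact Subtype.ext htv.symm
    · rintro ⟨v, rfl⟩
      exact ⟨⟨(u : K) * v, hmem u u.2 v v.2⟩, ⟨v, v.2, rfl⟩, rfl⟩
  · -- case (ii): the classes of `vI` span `W`
    refine Or.inr ⟨v, v.2, span_coe_eq_span_singleton_mul_of_span_mkQ_eq_top 𝔭 hT
      (fun u hu ↦ by rw [mul_comm]; exact hmem u hu v v.2) ?_⟩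
    have htop : Submodule.span (R ⧸ 𝔭) (Set.range fun u : I ↦
        (𝔭 • ⊤ : Submodule R T).mkQ ⟨(u : K) * v, hmem u u.2 v v.2⟩) = ⊤ :=
      Submodule.eq_top_of_finrank_eq (le_antisymm (Submodule.finrank_le _) (h2 ▸ hv))
    rw [← htop]
    congr 1
    ext w
    constructor
    · rintro ⟨t, ⟨u, hu, htu⟩, rfl⟩
      refine ⟨⟨u, hu⟩, ?_⟩
      change (𝔭 • ⊤ : Submodule R T).mkQ _ = _
      congr 1
      exact Subtype.ext (show u * (v : K) = (t : K) by rw [htu, mul_comm])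
    · rintro ⟨u, rfl⟩
      exact ⟨⟨(u : K) * v, hmem u u.2 v v.2⟩, ⟨u, u.2, show (u : K) * v = v * u from mul_comm _ _⟩, rfl⟩

end AnyDomain

/-- Transfer of `dim_{R/𝔭} M/𝔭M` along an `R`-linear isomorphism `M ≅ M′` (the induced additive isomorphism
`M/𝔭M ≅ M′/𝔭M′` commutes with the `R/𝔭`-action). [cite: Marseglia2024CMType, §2.5 Lemma 2.12 (iii) («the
`S/𝔭`-vector space `I/𝔭I`»), p. 7] -/
theorem finrank_quotient_smul_top_eq_of_linearEquiv {R : Type*} [CommRing R] (𝔭 : Ideal R) {M M' : Type*}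
    [AddCommGroup M] [Module R M] [AddCommGroup M'] [Module R M'] (e : M ≃ₗ[R] M') :
    Module.finrank (R ⧸ 𝔭) (M ⧸ (𝔭 • ⊤ : Submodule R M)) =
      Module.finrank (R ⧸ 𝔭) (M' ⧸ (𝔭 • ⊤ : Submodule R M')) := by
  have he : Submodule.map e.toLinearMap (𝔭 • ⊤ : Submodule R M) = (𝔭 • ⊤ : Submodule R M') := by
    rw [Submodule.map_smul'', Submodule.map_top, LinearEquiv.range]
  obtain ⟨j, hj⟩ : ∃ j : (M ⧸ (𝔭 • ⊤ : Submodule R M)) ≃+ (M' ⧸ (𝔭 • ⊤ : Submodule R M')),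
      ∀ y, j (Submodule.Quotient.mk y) = Submodule.Quotient.mk (e y) :=
    ⟨(Submodule.Quotient.equiv _ _ e he).toAddEquiv, fun _ ↦ rfl⟩
  have hr := lift_rank_eq_of_equiv_equiv (R := R ⧸ 𝔭) (R' := R ⧸ 𝔭) id j Function.bijective_id (fun c m ↦ by
      obtain ⟨a, rfl⟩ := Ideal.Quotient.mk_surjective c
      obtain ⟨y, rfl⟩ := Submodule.Quotient.mk_surjective _ m
      rw [id_eq, Module.Quotient.mk_smul_mk, hj, hj, Module.Quotient.mk_smul_mk, LinearEquiv.map_smul])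
  simpa [Module.finrank] using congr_arg Cardinal.toNat hr

section AnyDomain

variable {R : Type*} [CommRing R] [IsDomain R] {K : Type*} [Field K] [Algebra R K] [IsFractionRing R K]

/-- **`dim_{R/𝔭} I/𝔭I` only depends on the local component `I_𝔭`**: `I_𝔭 = J_𝔭 ⟹ dim I/𝔭I = dim J/𝔭J`
(both are the dimension of `I_𝔭/(𝔭R_𝔭)I_𝔭`, `CMOrderLocalMinimalGenerators`). [cite: Marseglia2024CMType, §4,
proof of Lemma 4.2 («`gens_{S_𝔭}(I_𝔭) = dim_{S/𝔭}(I/𝔭I)`»), p. 10] -/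
theorem finrank_quotient_smul_top_eq_of_span_coe_eq (𝔭 : Ideal R) [𝔭.IsMaximal] {I J : Submodule R K}
    (h : Submodule.span (Localization.subalgebra.ofField K 𝔭.primeCompl 𝔭.primeCompl_le_nonZeroDivisors)
        (I : Set K) =
      Submodule.span (Localization.subalgebra.ofField K 𝔭.primeCompl 𝔭.primeCompl_le_nonZeroDivisors) (J : Set K)) :
    Module.finrank (R ⧸ 𝔭) (I ⧸ (𝔭 • ⊤ : Submodule R I)) =
      Module.finrank (R ⧸ 𝔭) (J ⧸ (𝔭 • ⊤ : Submodule R J)) := by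
  rw [finrank_quotient_smul_top_eq_finrank_quotient_span_coe 𝔭 I,
    finrank_quotient_smul_top_eq_finrank_quotient_span_coe 𝔭 J, h]

/-- **Locally isomorphic lattices have the same `dim I/𝔭I`: `I_𝔭 = x·J_𝔭` (`x ≠ 0`) `⟹ dim_{R/𝔭} I/𝔭I =
dim_{R/𝔭} J/𝔭J`** (`xJ ≅ J` as `R`-modules and `(xJ)_𝔭 = x·J_𝔭 = I_𝔭`). [cite: Marseglia2024CMType, §6 Cor. 6.3
(proof: «`gens_{S_𝔭}(I_𝔭) = dim_{S/𝔭}(I/𝔭I)`» read on `I_𝔭 ≃ S_𝔭`, `I_𝔭 ≃ (Sᵗ)_𝔭`), p. 14]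
[cite: Marseglia2025LocalIsomorphism, §3 Def. 3.1, p. 6] -/
theorem finrank_quotient_smul_top_eq_of_span_coe_eq_span_singleton_mul (𝔭 : Ideal R) [h𝔭 : 𝔭.IsMaximal]
    {I J : Submodule R K} {x : K} (hx : x ≠ 0)
    (h : Submodule.span (Localization.subalgebra.ofField K 𝔭.primeCompl 𝔭.primeCompl_le_nonZeroDivisors)
        (I : Set K) =
      Submodule.span (Localization.subalgebra.ofField K 𝔭.primeCompl 𝔭.primeCompl_le_nonZeroDivisors) {x} *
        Submodule.span (Localization.subalgebra.ofField K 𝔭.primeCompl 𝔭.primeCompl_le_nonZeroDivisors)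
          (J : Set K)) :
    Module.finrank (R ⧸ 𝔭) (I ⧸ (𝔭 • ⊤ : Submodule R I)) =
      Module.finrank (R ⧸ 𝔭) (J ⧸ (𝔭 • ⊤ : Submodule R J)) := by
  -- `N = xJ ≅ J` as `R`-modules, and `N_𝔭 = x·J_𝔭 = I_𝔭`
  have hinj : Function.Injective (LinearMap.mulLeft R x : K →ₗ[R] K) := mul_right_injective₀ hx
  have hN : ((J.map (LinearMap.mulLeft R x : K →ₗ[R] K) : Submodule R K) : Set K) = ({x} : Set K) * (J : Set K) := by
    rw [Submodule.map_coe, Set.singleton_mul]; rfl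
  have hspan : Submodule.span (Localization.subalgebra.ofField K 𝔭.primeCompl 𝔭.primeCompl_le_nonZeroDivisors)
        (I : Set K) =
      Submodule.span (Localization.subalgebra.ofField K 𝔭.primeCompl 𝔭.primeCompl_le_nonZeroDivisors)
        ((J.map (LinearMap.mulLeft R x : K →ₗ[R] K) : Submodule R K) : Set K) := by
    rw [hN, ← Submodule.span_mul_span, h]
  rw [finrank_quotient_smul_top_eq_of_span_coe_eq 𝔭 hspan]
  exact (finrank_quotient_smul_top_eq_of_linearEquiv 𝔭 (Submodule.equivMapOfInjective _ hinj J)).symm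

end AnyDomain

end NumberRing

/-! ## §3 THEOREM 6.2 = MAIN THEOREM 3 (1) for the order `𝔯 = endOrder (M_μ)` -/

namespace CMTypeLattice

variable {K : Type} [Field K] [NumberField K]
variable {ι : Type} [Fintype ι] [DecidableEq ι] [Nonempty ι] (μ : Basis ι ℚ K)
variable [IsFractionRing (endOrder (Algebra.leftMulMatrix μ)) K]

/-- **MARSEGLIA 2024 THEOREM 6.2 = MAIN THEOREM 3 (1): let `𝔭 ≠ 0` be a prime of the order `𝔯 = endOrder (M_μ)`
with `type_𝔭(𝔯) = dim_{𝔯/𝔭} 𝔯ᵗ/𝔭𝔯ᵗ = 2`, and `I` a fractional ideal with multiplicator ring `(I:I) = 𝔯`. Then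
either `I_𝔭 ≃ 𝔯_𝔭` or `I_𝔭 ≃ (𝔯ᵗ)_𝔭`** — `I_𝔭 = x·𝔯_𝔭` or `I_𝔭 = x·𝔯ᵗ_𝔭` for some `x ∈ K^*` (`↑T = 𝔯ᵗ`).  Proof
as printed up to the Nakayama step (`IIᵗ = 𝔯ᵗ`, Lemma 6.1 on `I/𝔭I × Iᵗ/𝔭Iᵗ → 𝔯ᵗ/𝔭𝔯ᵗ`); case (ii) `𝔯ᵗ_𝔭 = v·I_𝔭`
is the second alternative, case (i) `𝔯ᵗ_𝔭 = u·Iᵗ_𝔭` gives `1 ∈ (𝔯ᵗ:Iᵗ)(Iᵗ:𝔯ᵗ) + 𝔭 = (I:𝔯)(𝔯:I) + 𝔭`, i.e. `I` is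
`𝔭`-equivalent to `𝔯`, hence `I_𝔭 = x·𝔯_𝔭`. [cite: Marseglia2024CMType, §6 Thm. 6.2, p. 13; §1 Main Theorem 3 (1),
p. 3] -/
theorem exists_span_coe_eq_span_singleton_mul_of_finrank_traceDual_quotient_eq_two
    {T : FractionalIdeal (endOrder (Algebra.leftMulMatrix μ))⁰ K}
    (hT : (T : Submodule (endOrder (Algebra.leftMulMatrix μ)) K) =
      traceDual ℤ ℚ ((1 : FractionalIdeal (endOrder (Algebra.leftMulMatrix μ))⁰ K) :
        Submodule (endOrder (Algebra.leftMulMatrix μ)) K))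
    {𝔭 : Ideal (endOrder (Algebra.leftMulMatrix μ))} [h𝔭 : 𝔭.IsPrime] (h0 : 𝔭 ≠ ⊥)
    (h2 : Module.finrank (endOrder (Algebra.leftMulMatrix μ) ⧸ 𝔭)
      ((T : Submodule (endOrder (Algebra.leftMulMatrix μ)) K) ⧸
        (𝔭 • ⊤ : Submodule (endOrder (Algebra.leftMulMatrix μ))
          (T : Submodule (endOrder (Algebra.leftMulMatrix μ)) K))) = 2)
    {I : FractionalIdeal (endOrder (Algebra.leftMulMatrix μ))⁰ K} (hI : I ≠ 0) (hII : I / I = 1) :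
    (∃ x : K, x ≠ 0 ∧
      Submodule.span (Localization.subalgebra.ofField K 𝔭.primeCompl 𝔭.primeCompl_le_nonZeroDivisors) (I : Set K) =
        Submodule.span (Localization.subalgebra.ofField K 𝔭.primeCompl 𝔭.primeCompl_le_nonZeroDivisors) {x} *
          Submodule.span (Localization.subalgebra.ofField K 𝔭.primeCompl 𝔭.primeCompl_le_nonZeroDivisors)
            ((1 : FractionalIdeal (endOrder (Algebra.leftMulMatrix μ))⁰ K) : Set K)) ∨
    ∃ x : K, x ≠ 0 ∧
      Submodule.span (Localization.subalgebra.ofField K 𝔭.primeCompl 𝔭.primeCompl_le_nonZeroDivisors) (I : Set K) =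
        Submodule.span (Localization.subalgebra.ofField K 𝔭.primeCompl 𝔭.primeCompl_le_nonZeroDivisors) {x} *
          Submodule.span (Localization.subalgebra.ofField K 𝔭.primeCompl 𝔭.primeCompl_le_nonZeroDivisors)
            (T : Set K) := by
  set A := Localization.subalgebra.ofField K 𝔭.primeCompl 𝔭.primeCompl_le_nonZeroDivisors with hA
  haveI := isMaximal_of_isPrime_endOrder (Algebra.leftMulMatrix μ) h𝔭 h0
  haveI := isNoetherianRing_endOrder (Algebra.leftMulMatrix μ)
  have hT0 : T ≠ 0 := ne_zero_of_coe_eq_traceDual_one μ hT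
  have h10 : (1 : FractionalIdeal (endOrder (Algebra.leftMulMatrix μ))⁰ K) ≠ 0 := one_ne_zero
  -- `Iᵗ` and `I·Iᵗ = 𝔯ᵗ` (Lemma 2.4 (iii): `(I:I) = 𝔯 ⟺ IIᵗ = 𝔯ᵗ`)
  obtain ⟨TI, hTI0, hTI⟩ := exists_coe_eq_traceDual μ hI
  have hmul : I * TI = T := (div_self_eq_iff_mul_traceDual_eq μ hI hTI0 h10 hTI hT).1 hII
  have hmul' : (I : Submodule (endOrder (Algebra.leftMulMatrix μ)) K) * TI = T := by rw [← coe_mul, hmul]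
  -- Lemma 6.1 + Nakayama
  obtain ⟨u, -, h⟩ | ⟨v, -, h⟩ :=
    NumberRing.exists_span_coe_eq_span_singleton_mul_or_of_finrank_eq_two 𝔭 (fg_of_isNoetherianRing le_rfl T) hmul' h2
  · -- case (i): `𝔯ᵗ_𝔭 = u·Iᵗ_𝔭`, so `I` is `𝔭`-equivalent to `𝔯`
    rw [coeToSet_coeToSubmodule, coeToSet_coeToSubmodule] at h
    have h1 := NumberRing.one_mem_add_coeIdeal_of_span_coe_eq hT0 hTI0 𝔭 h
    -- `(𝔯ᵗ:Iᵗ) = (I:𝔯)` and `(Iᵗ:𝔯ᵗ) = (𝔯:I)`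
    rw [← div_eq_div_of_coe_eq_traceDual μ hI h10 hTI0 hTI hT, ← div_eq_div_of_coe_eq_traceDual μ h10 hI hT0 hT hTI]
      at h1
    exact Or.inl (exists_ne_zero_span_coe_eq_of_one_mem_add_coeIdeal μ hI h10 𝔭 h1)
  · -- case (ii): `𝔯ᵗ_𝔭 = v·I_𝔭`, so `I_𝔭 = v⁻¹·𝔯ᵗ_𝔭`
    rw [coeToSet_coeToSubmodule, coeToSet_coeToSubmodule] at h
    have hv0 : v ≠ 0 := NumberRing.ne_zero_of_span_coe_eq_span_singleton_mul hT0 𝔭 h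
    refine Or.inr ⟨v⁻¹, inv_ne_zero hv0, ?_⟩
    rw [h, ← mul_assoc, Submodule.span_mul_span, Set.singleton_mul_singleton, inv_mul_cancel₀ hv0,
      ← Submodule.one_eq_span, one_mul]

/-- **THEOREM 6.2, the same with the first alternative read as «`I_𝔭` is principal»: at a prime with `type_𝔭(𝔯) = 2`,
every `I` with `(I:I) = 𝔯` has `I_𝔭` principal or `I_𝔭 = x·𝔯ᵗ_𝔭`.** [cite: Marseglia2024CMType, §6 Thm. 6.2, p. 13] -/
theorem isPrincipal_span_coe_or_exists_span_coe_eq_of_finrank_traceDual_quotient_eq_two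
    {T : FractionalIdeal (endOrder (Algebra.leftMulMatrix μ))⁰ K}
    (hT : (T : Submodule (endOrder (Algebra.leftMulMatrix μ)) K) =
      traceDual ℤ ℚ ((1 : FractionalIdeal (endOrder (Algebra.leftMulMatrix μ))⁰ K) :
        Submodule (endOrder (Algebra.leftMulMatrix μ)) K))
    {𝔭 : Ideal (endOrder (Algebra.leftMulMatrix μ))} [h𝔭 : 𝔭.IsPrime] (h0 : 𝔭 ≠ ⊥)
    (h2 : Module.finrank (endOrder (Algebra.leftMulMatrix μ) ⧸ 𝔭)
      ((T : Submodule (endOrder (Algebra.leftMulMatrix μ)) K) ⧸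
        (𝔭 • ⊤ : Submodule (endOrder (Algebra.leftMulMatrix μ))
          (T : Submodule (endOrder (Algebra.leftMulMatrix μ)) K))) = 2)
    {I : FractionalIdeal (endOrder (Algebra.leftMulMatrix μ))⁰ K} (hI : I ≠ 0) (hII : I / I = 1) :
    (Submodule.span (Localization.subalgebra.ofField K 𝔭.primeCompl 𝔭.primeCompl_le_nonZeroDivisors)
        (I : Set K)).IsPrincipal ∨
    ∃ x : K, x ≠ 0 ∧
      Submodule.span (Localization.subalgebra.ofField K 𝔭.primeCompl 𝔭.primeCompl_le_nonZeroDivisors) (I : Set K) =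
        Submodule.span (Localization.subalgebra.ofField K 𝔭.primeCompl 𝔭.primeCompl_le_nonZeroDivisors) {x} *
          Submodule.span (Localization.subalgebra.ofField K 𝔭.primeCompl 𝔭.primeCompl_le_nonZeroDivisors)
            (T : Set K) := by
  obtain ⟨x, -, hx⟩ | h := exists_span_coe_eq_span_singleton_mul_of_finrank_traceDual_quotient_eq_two μ hT h0 h2 hI hII
  · refine Or.inl ⟨⟨x, ?_⟩⟩
    rw [hx, NumberRing.span_coe_one, Submodule.span_mul_span, Set.singleton_mul_singleton, mul_one]
  · exact Or.inr h

/-! ## §4 COROLLARY 6.3: type two and the number of generators -/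

/-- **COROLLARY 6.3, prime by prime: if `type_𝔭(𝔯) = 2` then `dim_{𝔯/𝔭} I/𝔭I ≤ 2` for every fractional ideal `I`
with `(I:I) = 𝔯`** («By Theorem 6.2 we have `gens_{S_𝔭}(I_𝔭) ≤ 2`»: `I_𝔭 ≃ 𝔯_𝔭` has `dim = 1`, `I_𝔭 ≃ 𝔯ᵗ_𝔭` has
`dim I/𝔭I = dim 𝔯ᵗ/𝔭𝔯ᵗ = 2`). [cite: Marseglia2024CMType, §6 Cor. 6.3 (proof), p. 14] -/
theorem finrank_quotient_smul_top_le_two_of_finrank_traceDual_quotient_eq_two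
    {T : FractionalIdeal (endOrder (Algebra.leftMulMatrix μ))⁰ K}
    (hT : (T : Submodule (endOrder (Algebra.leftMulMatrix μ)) K) =
      traceDual ℤ ℚ ((1 : FractionalIdeal (endOrder (Algebra.leftMulMatrix μ))⁰ K) :
        Submodule (endOrder (Algebra.leftMulMatrix μ)) K))
    {𝔭 : Ideal (endOrder (Algebra.leftMulMatrix μ))} [h𝔭 : 𝔭.IsPrime] (h0 : 𝔭 ≠ ⊥)
    (h2 : Module.finrank (endOrder (Algebra.leftMulMatrix μ) ⧸ 𝔭)
      ((T : Submodule (endOrder (Algebra.leftMulMatrix μ)) K) ⧸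
        (𝔭 • ⊤ : Submodule (endOrder (Algebra.leftMulMatrix μ))
          (T : Submodule (endOrder (Algebra.leftMulMatrix μ)) K))) = 2)
    {I : FractionalIdeal (endOrder (Algebra.leftMulMatrix μ))⁰ K} (hI : I ≠ 0) (hII : I / I = 1) :
    Module.finrank (endOrder (Algebra.leftMulMatrix μ) ⧸ 𝔭)
      ((I : Submodule (endOrder (Algebra.leftMulMatrix μ)) K) ⧸
        (𝔭 • ⊤ : Submodule (endOrder (Algebra.leftMulMatrix μ))
          (I : Submodule (endOrder (Algebra.leftMulMatrix μ)) K))) ≤ 2 := by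
  haveI := isMaximal_of_isPrime_endOrder (Algebra.leftMulMatrix μ) h𝔭 h0
  obtain hP | ⟨x, hx0, hx⟩ :=
    isPrincipal_span_coe_or_exists_span_coe_eq_of_finrank_traceDual_quotient_eq_two μ hT h0 h2 hI hII
  · rw [(EndOrder.isPrincipal_span_coe_iff_finrank_quotient_eq_one hI h0).1 hP]
    norm_num
  · rw [← coeToSet_coeToSubmodule, ← coeToSet_coeToSubmodule] at hx
    rw [NumberRing.finrank_quotient_smul_top_eq_of_span_coe_eq_span_singleton_mul 𝔭 hx0 hx, h2]

/-- **COROLLARY 6.3 (`⟹`, globally): if `type_𝔭(𝔯) ≤ 2` at every prime then every fractional ideal with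
multiplicator ring `𝔯` is generated by two elements, `gens_𝔯(I) ≤ 2`** (at a prime of type `1` the ideal is locally
principal — PROP. 3.4 prime by prime, `CMOrderCohenMacaulayTypeOne` —, at a prime of type `2` the local bound above;
then LEMMA 4.2 of `CMOrderIdealGeneratorsCount`). [cite: Marseglia2024CMType, §6 Cor. 6.3 (proof: «by Lemma 4.2, we
also have `gens_S(I) ≤ 2`»), p. 14] -/
theorem spanFinrank_le_two_of_forall_finrank_traceDual_quotient_le_two
    {T : FractionalIdeal (endOrder (Algebra.leftMulMatrix μ))⁰ K}
    (hT : (T : Submodule (endOrder (Algebra.leftMulMatrix μ)) K) =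
      traceDual ℤ ℚ ((1 : FractionalIdeal (endOrder (Algebra.leftMulMatrix μ))⁰ K) :
        Submodule (endOrder (Algebra.leftMulMatrix μ)) K))
    (h : ∀ 𝔭 : MaximalSpectrum (endOrder (Algebra.leftMulMatrix μ)),
      Module.finrank (endOrder (Algebra.leftMulMatrix μ) ⧸ 𝔭.asIdeal)
        ((T : Submodule (endOrder (Algebra.leftMulMatrix μ)) K) ⧸
          (𝔭.asIdeal • ⊤ : Submodule (endOrder (Algebra.leftMulMatrix μ))
            (T : Submodule (endOrder (Algebra.leftMulMatrix μ)) K))) ≤ 2)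
    {I : FractionalIdeal (endOrder (Algebra.leftMulMatrix μ))⁰ K} (hI : I ≠ 0) (hII : I / I = 1) :
    (I : Submodule (endOrder (Algebra.leftMulMatrix μ)) K).spanFinrank ≤ 2 := by
  refine EndOrder.spanFinrank_le_of_forall_finrank_quotient_le hI (n := 1) le_rfl fun 𝔭 ↦ ?_
  haveI := 𝔭.isMaximal
  have h0 : 𝔭.asIdeal ≠ ⊥ := Ring.ne_bot_of_isMaximal_of_not_isField 𝔭.isMaximal EndOrder.not_isField
  have hpos := finrank_traceDual_quotient_pos μ hT h0
  by_cases h1 : Module.finrank (endOrder (Algebra.leftMulMatrix μ) ⧸ 𝔭.asIdeal)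
      ((T : Submodule (endOrder (Algebra.leftMulMatrix μ)) K) ⧸
        (𝔭.asIdeal • ⊤ : Submodule (endOrder (Algebra.leftMulMatrix μ))
          (T : Submodule (endOrder (Algebra.leftMulMatrix μ)) K))) = 1
  · -- type `1` at `𝔭`: `I_𝔭` is principal
    rw [(EndOrder.isPrincipal_span_coe_iff_finrank_quotient_eq_one hI h0).1
      (isPrincipal_span_coe_of_finrank_traceDual_quotient_eq_one μ hT h0 h1 hI hII)]
    norm_num
  · -- type `2` at `𝔭`
    have h2 : Module.finrank (endOrder (Algebra.leftMulMatrix μ) ⧸ 𝔭.asIdeal)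
        ((T : Submodule (endOrder (Algebra.leftMulMatrix μ)) K) ⧸
          (𝔭.asIdeal • ⊤ : Submodule (endOrder (Algebra.leftMulMatrix μ))
            (T : Submodule (endOrder (Algebra.leftMulMatrix μ)) K))) = 2 := by
      have := h 𝔭; omega
    exact finrank_quotient_smul_top_le_two_of_finrank_traceDual_quotient_eq_two μ hT h0 h2 hI hII

/-- **COROLLARY 6.3 (`⟸`, globally): if every fractional ideal with multiplicator ring `𝔯` is generated by two
elements then `type_𝔭(𝔯) ≤ 2` at every prime** (take `I = 𝔯ᵗ`, whose multiplicator ring is `𝔯`: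
`dim 𝔯ᵗ/𝔭𝔯ᵗ ≤ gens_𝔯(𝔯ᵗ) ≤ 2`). [cite: Marseglia2024CMType, §6 Cor. 6.3 (proof: «assume that `m = 2` […] hence
`gens_S(Sᵗ) = 2`. Hence we get that `type(S) = 2`»), p. 14] -/
theorem finrank_traceDual_quotient_le_two_of_forall_spanFinrank_le_two
    {T : FractionalIdeal (endOrder (Algebra.leftMulMatrix μ))⁰ K}
    (hT : (T : Submodule (endOrder (Algebra.leftMulMatrix μ)) K) =
      traceDual ℤ ℚ ((1 : FractionalIdeal (endOrder (Algebra.leftMulMatrix μ))⁰ K) :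
        Submodule (endOrder (Algebra.leftMulMatrix μ)) K))
    (h : ∀ I : FractionalIdeal (endOrder (Algebra.leftMulMatrix μ))⁰ K, I ≠ 0 → I / I = 1 →
      (I : Submodule (endOrder (Algebra.leftMulMatrix μ)) K).spanFinrank ≤ 2)
    {𝔭 : Ideal (endOrder (Algebra.leftMulMatrix μ))} [h𝔭 : 𝔭.IsPrime] (h0 : 𝔭 ≠ ⊥) :
    Module.finrank (endOrder (Algebra.leftMulMatrix μ) ⧸ 𝔭)
      ((T : Submodule (endOrder (Algebra.leftMulMatrix μ)) K) ⧸
        (𝔭 • ⊤ : Submodule (endOrder (Algebra.leftMulMatrix μ))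
          (T : Submodule (endOrder (Algebra.leftMulMatrix μ)) K))) ≤ 2 := by
  have hT0 : T ≠ 0 := ne_zero_of_coe_eq_traceDual_one μ hT
  exact (EndOrder.finrank_quotient_smul_top_le_spanFinrank T h0).trans
    (h T hT0 (traceDual_div_traceDual_eq_of_mul_self_eq μ (one_mul 1) one_ne_zero hT0 hT))

/-- **COROLLARY 6.3 as an equivalence of bounds: `type_𝔭(𝔯) ≤ 2` at every prime `⟺ gens_𝔯(I) ≤ 2` for every
fractional ideal `I` with `(I:I) = 𝔯`.** [cite: Marseglia2024CMType, §6 Cor. 6.3, p. 14] -/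
theorem forall_finrank_traceDual_quotient_le_two_iff
    {T : FractionalIdeal (endOrder (Algebra.leftMulMatrix μ))⁰ K}
    (hT : (T : Submodule (endOrder (Algebra.leftMulMatrix μ)) K) =
      traceDual ℤ ℚ ((1 : FractionalIdeal (endOrder (Algebra.leftMulMatrix μ))⁰ K) :
        Submodule (endOrder (Algebra.leftMulMatrix μ)) K)) :
    (∀ 𝔭 : MaximalSpectrum (endOrder (Algebra.leftMulMatrix μ)),
      Module.finrank (endOrder (Algebra.leftMulMatrix μ) ⧸ 𝔭.asIdeal)
        ((T : Submodule (endOrder (Algebra.leftMulMatrix μ)) K) ⧸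
          (𝔭.asIdeal • ⊤ : Submodule (endOrder (Algebra.leftMulMatrix μ))
            (T : Submodule (endOrder (Algebra.leftMulMatrix μ)) K))) ≤ 2) ↔
      ∀ I : FractionalIdeal (endOrder (Algebra.leftMulMatrix μ))⁰ K, I ≠ 0 → I / I = 1 →
        (I : Submodule (endOrder (Algebra.leftMulMatrix μ)) K).spanFinrank ≤ 2 := by
  refine ⟨fun h I hI hII ↦ spanFinrank_le_two_of_forall_finrank_traceDual_quotient_le_two μ hT h hI hII,
    fun h 𝔭 ↦ ?_⟩
  haveI := 𝔭.isMaximal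
  exact finrank_traceDual_quotient_le_two_of_forall_spanFinrank_le_two μ hT h
    (Ring.ne_bot_of_isMaximal_of_not_isField 𝔭.isMaximal EndOrder.not_isField)

/-- **If `type_𝔭(𝔯) ≤ 2` everywhere and `type_𝔭(𝔯) = 2` at some prime, the trace dual needs exactly two generators:
`gens_𝔯(𝔯ᵗ) = 2`** (LEMMA 4.2, equality case `m = 2`; «Since `(Sᵗ:Sᵗ) = S` we then have `m ≥ 2`»).
[cite: Marseglia2024CMType, §6 Cor. 6.3 (proof), p. 14; §4 Lemma 4.2, p. 10] -/
theorem spanFinrank_traceDual_eq_two {T : FractionalIdeal (endOrder (Algebra.leftMulMatrix μ))⁰ K}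
    (hT : (T : Submodule (endOrder (Algebra.leftMulMatrix μ)) K) =
      traceDual ℤ ℚ ((1 : FractionalIdeal (endOrder (Algebra.leftMulMatrix μ))⁰ K) :
        Submodule (endOrder (Algebra.leftMulMatrix μ)) K))
    (h : ∀ 𝔭 : MaximalSpectrum (endOrder (Algebra.leftMulMatrix μ)),
      Module.finrank (endOrder (Algebra.leftMulMatrix μ) ⧸ 𝔭.asIdeal)
        ((T : Submodule (endOrder (Algebra.leftMulMatrix μ)) K) ⧸
          (𝔭.asIdeal • ⊤ : Submodule (endOrder (Algebra.leftMulMatrix μ))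
            (T : Submodule (endOrder (Algebra.leftMulMatrix μ)) K))) ≤ 2)
    (h2 : ∃ 𝔭 : MaximalSpectrum (endOrder (Algebra.leftMulMatrix μ)),
      Module.finrank (endOrder (Algebra.leftMulMatrix μ) ⧸ 𝔭.asIdeal)
        ((T : Submodule (endOrder (Algebra.leftMulMatrix μ)) K) ⧸
          (𝔭.asIdeal • ⊤ : Submodule (endOrder (Algebra.leftMulMatrix μ))
            (T : Submodule (endOrder (Algebra.leftMulMatrix μ)) K))) = 2) :
    (T : Submodule (endOrder (Algebra.leftMulMatrix μ)) K).spanFinrank = 2 :=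
  EndOrder.spanFinrank_eq_of_forall_finrank_quotient_le (ne_zero_of_coe_eq_traceDual_one μ hT) le_rfl h h2

/-- **MARSEGLIA 2024 COROLLARY 6.3 AS PRINTED: for a non-Gorenstein order (some `type_𝔭(𝔯) ≠ 1`), `type(𝔯) = 2` —
`type_𝔭(𝔯) ≤ 2` at every prime, with equality somewhere — iff `max{gens_𝔯(I) : (I:I) = 𝔯} = 2` — every such `I` is
`2`-generated and some such `I` needs `2` generators.** [cite: Marseglia2024CMType, §6 Cor. 6.3, p. 14] -/
theorem type_eq_two_iff_gens_eq_two {T : FractionalIdeal (endOrder (Algebra.leftMulMatrix μ))⁰ K}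
    (hT : (T : Submodule (endOrder (Algebra.leftMulMatrix μ)) K) =
      traceDual ℤ ℚ ((1 : FractionalIdeal (endOrder (Algebra.leftMulMatrix μ))⁰ K) :
        Submodule (endOrder (Algebra.leftMulMatrix μ)) K))
    (hnG : ¬ ∀ 𝔭 : MaximalSpectrum (endOrder (Algebra.leftMulMatrix μ)),
      Module.finrank (endOrder (Algebra.leftMulMatrix μ) ⧸ 𝔭.asIdeal)
        ((T : Submodule (endOrder (Algebra.leftMulMatrix μ)) K) ⧸
          (𝔭.asIdeal • ⊤ : Submodule (endOrder (Algebra.leftMulMatrix μ))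
            (T : Submodule (endOrder (Algebra.leftMulMatrix μ)) K))) = 1) :
    ((∀ 𝔭 : MaximalSpectrum (endOrder (Algebra.leftMulMatrix μ)),
      Module.finrank (endOrder (Algebra.leftMulMatrix μ) ⧸ 𝔭.asIdeal)
        ((T : Submodule (endOrder (Algebra.leftMulMatrix μ)) K) ⧸
          (𝔭.asIdeal • ⊤ : Submodule (endOrder (Algebra.leftMulMatrix μ))
            (T : Submodule (endOrder (Algebra.leftMulMatrix μ)) K))) ≤ 2) ∧
      ∃ 𝔭 : MaximalSpectrum (endOrder (Algebra.leftMulMatrix μ)),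
        Module.finrank (endOrder (Algebra.leftMulMatrix μ) ⧸ 𝔭.asIdeal)
          ((T : Submodule (endOrder (Algebra.leftMulMatrix μ)) K) ⧸
            (𝔭.asIdeal • ⊤ : Submodule (endOrder (Algebra.leftMulMatrix μ))
              (T : Submodule (endOrder (Algebra.leftMulMatrix μ)) K))) = 2) ↔
    ((∀ I : FractionalIdeal (endOrder (Algebra.leftMulMatrix μ))⁰ K, I ≠ 0 → I / I = 1 →
        (I : Submodule (endOrder (Algebra.leftMulMatrix μ)) K).spanFinrank ≤ 2) ∧
      ∃ I : FractionalIdeal (endOrder (Algebra.leftMulMatrix μ))⁰ K, I ≠ 0 ∧ I / I = 1 ∧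
        (I : Submodule (endOrder (Algebra.leftMulMatrix μ)) K).spanFinrank = 2) := by
  have hT0 : T ≠ 0 := ne_zero_of_coe_eq_traceDual_one μ hT
  have hTT : T / T = 1 := traceDual_div_traceDual_eq_of_mul_self_eq μ (one_mul 1) one_ne_zero hT0 hT
  push Not at hnG
  obtain ⟨𝔮, h𝔮⟩ := hnG
  have h𝔮0 : 𝔮.asIdeal ≠ ⊥ := Ring.ne_bot_of_isMaximal_of_not_isField 𝔮.isMaximal EndOrder.not_isField
  haveI := 𝔮.isMaximal
  have h𝔮pos := finrank_traceDual_quotient_pos μ hT h𝔮0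
  constructor
  · rintro ⟨hle, -⟩
    refine ⟨(forall_finrank_traceDual_quotient_le_two_iff μ hT).1 hle, T, hT0, hTT, ?_⟩
    exact spanFinrank_traceDual_eq_two μ hT hle ⟨𝔮, by have := hle 𝔮; omega⟩
  · rintro ⟨hle, -⟩
    have hle' := (forall_finrank_traceDual_quotient_le_two_iff μ hT).2 hle
    exact ⟨hle', 𝔮, by have := hle' 𝔮; omega⟩

end CMTypeLattice

end Literature.NumberTheory.ComplexMultiplication
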